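import Literature.Geometry.Kaehler.ComplexTorusHodgeGroupHodgeCircleSigmaPiHodgeClasses
import Literature.Geometry.Kaehler.ComplexTorusHodgeLieAlgebraIsogeny
import Literature.Geometry.Kaehler.ComplexTorusMumfordTateLieAlgebra
import HarnessLib

/-!
# The rank of the Hodge group of a finite product of complex tori on the Hodge-circle locus is the number of
# `Hom`-classes of the factors: `dim_ℝ 𝔥𝔤_ℝ(∏ₖ X_k) = r`, `dim_ℝ 𝔪𝔱_ℝ(∏ₖ X_k) = r + 1`, `1 ≤ r ≤ #κ`
# (Imai 1976, §2 and §3 Remarks; Moonen–Zarhin 1999, (0.2)(4), §1, §3 Corollary; Gordon 1997, §3 Theorem;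
# Green–Griffiths–Kerr 2012, §I.A, §III.B (i))

Layer `Literature/Geometry/Kaehler`, namespace `Literature.Geometry.Kaehler.ComplexTorus`; lane `lit-hodgefound` (Track 2
foundations library, Layer A1/A3 «Hodge groups of complex tori; products»), prover seat p17, generation 34, self-proposed row
g34-#2 — pointer (δ) of the gen-33 HANDOFF, the LIE-ALGEBRA companion of g33-#7 (`ComplexTorusHodgeGroupHodgeCircleSigmaPiCMClasses`:
`Hg(∏ₖ X_k)(ℝ) ≃* Hg(∏_ν E_{τ_ν})(ℝ) = ∏_ν h_ν(S¹)` over the `1 ≤ r ≤ #κ` CM isogeny classes) and of g34-#1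
(`ComplexTorusHodgeGroupHodgeCircleSigmaPiHodgeClasses`: colourings of the factors by `Hom`-classes, `∏ₖ X_k ∼ ∏_t E_{σ_{c(t)}} ∼
∏ᵢ E_{σᵢ}^{nᵢ}`).  The rank is read INFINITESIMALLY: `dim_ℝ 𝔥𝔤_ℝ` is an isogeny invariant (the tree's
`IsIsogenous.finrank_hodgeGroupLie_eq`, `ComplexTorusHodgeLieAlgebraIsogeny`), and on `∏_ν E_{τ_ν}^{n_ν}` — a family of tori on
the locus with pairwise `Hom = 0` — g33-#5's `finrank_hodgeGroupLie_sigmaPiPeriod_eq_card_of_coe_eq_range_of_pairwise_homRat_eq_bot`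
gives `dim = r`; `dim 𝔪𝔱 = dim 𝔥𝔤 + 1` is the tree's `finrank_mumfordTateLie` (`ComplexTorusMumfordTateLieAlgebra`).  All BY
NAME.  THEOREMS ONLY: no definition, no instance, no named fact, nothing conditional (D-0026, net debt 0).

## Sources, verbatim

* H. Imai, *On the Hodge groups of some abelian varieties*, Kōdai Math. Sem. Rep. 27 (1976) (held
  `paper:doi-10-2996-kmj-1138847263`), §2 (p. 368 L5–L7): «`Hg(E)` is a `1`-dimensional torus if `E` is of CM-type»,
  Proposition (p. 368 L11–L13); §3 Remarks (p. 370 L31–L38): «For the product of elliptic curves (isogenous or not), its Hodge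
  group can be obtained as follows … `Hg(∏_{i,j} Eᵢ^{(j)}) ≅ ∏ᵢ Δ_{mᵢ}(Hg(Eᵢ))`» — a torus of rank the number of isogeny classes.
* B. Moonen, Yu. Zarhin, *Hodge classes on abelian varieties of low dimension*, Math. Ann. 315 (1999) (held
  `paper:arxiv-math_9901113`), (0.2)(4) (p0002 L1–L3: isogenous varieties, products with powers), §1 (p0002 L138–L141:
  «`Hg(X) = Hg(Y₁^{m₁}) × ⋯` … `Hg(Y^{m}) ≅ Hg(Y)`»; «`Hg(X)` is a torus if and only if `X` is of CM-type»), §3 Corollary.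
* B. B. Gordon, *A survey of the Hodge conjecture for abelian varieties* (1997), §3 Theorem (first bullet
  `Hg(A) = Hg(E_1) × ⋯ × Hg(E_r)` for `A = E_1^{n_1} × ⋯ × E_r^{n_r}`).
* M. Green, P. Griffiths, M. Kerr, *Mumford–Tate Groups and Domains* (2012), §I.A (p. 35: `M = 𝔾_m · Hg`, `dim MT = dim Hg + 1`),
  §III.B (i) (p. 72: products).
* H. Lange, *Abelian Varieties over the Complex Numbers* (2023), §7.2.1 Remark 7.2.2 (2), §7.2.3 Prop. 7.2.6, §2.4.4 Thm. 2.4.25.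

## What is proved (`X_k = F_k/Ψ_k(ℤ^{σ k})` on the locus, `g_k = dim X_k ≥ 1`, `∏ₖ X_k = sigmaPiPeriod Ψ`, real points)

* §1 **`dim_ℝ 𝔥𝔤_ℝ(E_{τ₁}^{n₁} × ⋯ × E_{τ_r}^{n_r}) = r`** for pairwise non-isogenous CM curves and `n_ν ≥ 1` (the powers
  `E_{τ_ν}^{n_ν}` are tori on the locus with pairwise `Hom = 0`), and `dim_ℝ 𝔪𝔱_ℝ = r + 1`
  (`finrank_hodgeGroupLie_sigmaPi_ellipticPow_eq_card`, `finrank_mumfordTateLie_sigmaPi_ellipticPow_eq_card_add_one`).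
* §2 **INTRINSICALLY: `dim_ℝ 𝔥𝔤_ℝ(∏ₖ X_k) = r`, THE NUMBER OF CM ISOGENY CLASSES OF THE FACTORS** — together with the data of
  g33-#8 §6 / g34-#1 §3 (`r ≤ #κ`, `n_ν ≥ 1`, `Σ n_ν = Σ g_k`, `ρ = Σ n_ν²`, `dim H^{2p}_Hodge = Σ_{Σ f = p} ∏ C(n_ν, f_ν)²`)
  (`exists_finrank_hodgeGroupLie_sigmaPiPeriod_eq_of_coe_eq_range`); `dim_ℝ 𝔪𝔱_ℝ(∏ₖ X_k) = r + 1`; `1 ≤ dim_ℝ 𝔥𝔤_ℝ(∏ₖ X_k) ≤ #κ`.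
* §3 **BY `Hom`-CLASSES: `dim_ℝ 𝔥𝔤_ℝ(∏ₖ X_k) = #R` and `dim_ℝ 𝔪𝔱_ℝ(∏ₖ X_k) = #R + 1` for EVERY colouring `d : κ ↠ R` with
  `d k = d l ⟺ Hom_ℚ(X_k, X_l) ≠ 0`** (`finrank_hodgeGroupLie_sigmaPiPeriod_eq_card_of_homColouring`); hence THE NUMBER OF
  `Hom`-CLASSES IS WELL DEFINED (`card_eq_card_of_homColouring`: two such colourings have equally many colours) and `≤ #κ`.
* §4 **`dim_ℝ 𝔥𝔤_ℝ(∏ₖ X_k) = 1` ⟺ `Hom_ℚ(X_k, X_l) ≠ 0` FOR ALL `k ≠ l`** ⟺ the product is itself on the locus (g33-#8 §4 gave ⟸);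
  with g33-#6's `dim = #κ ⟺` pairwise `Hom = 0` the two ends of the range `1 ≤ r ≤ #κ`.
* §5 **`𝔥𝔤_ℝ(∏ₖ X_k)` IS COMMUTATIVE** for every finite family on the locus (the Lie form of g33-#5's
  `hodgeGroup_sigmaPiPeriod_comm_of_coe_eq_range`; «`Hg(X)` is a torus iff `X` is of CM-type»).

## References

* [Imai1976HodgeGroups] H. Imai, Kōdai Math. Sem. Rep. 27 (1976) 367–372, §2, Proposition, §3 Remarks.
  [cite: Imai1976HodgeGroups, §2 (p. 368 L5–L7), Proposition (p. 368 L11–L13) and §3 Remarks (p. 370 L31–L38)]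
* [MoonenZarhin1999LowDim] B. Moonen, Yu. Zarhin, Math. Ann. 315 (1999) 711–733, (0.2)(4), §1, §3 Corollary.
  [cite: MoonenZarhin1999LowDim, (0.2)(4) (p0002 L1–L3), §1 (p0002 L138–L141) and §3 Corollary (p0007 L80–L85)]
* [Gordon1997] B. B. Gordon, *A survey of the Hodge conjecture for abelian varieties* (1997), §3 Theorem. [cite: Gordon1997, §3 Theorem (p0013 L55–L62)]
* [GreenGriffithsKerr2012] M. Green, P. Griffiths, M. Kerr, *Mumford–Tate Groups and Domains* (2012), §I.A, §III.B (i).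
  [cite: GreenGriffithsKerr2012, §I.A (p. 35) and §III.B (i) (p. 72)]
* [Lange2023AbelianVarietiesComplex] H. Lange (2023), §7.2.1 Remark 7.2.2 (2), §7.2.3 Prop. 7.2.6, §2.4.4 Thm. 2.4.25.
  [cite: Lange2023AbelianVarietiesComplex, §7.2.1 Remark 7.2.2 (2), §7.2.3 Prop. 7.2.6 and §2.4.4 Thm. 2.4.25]
* [Beauville2014MaximalPicard] A. Beauville (2014), §3 Prop. 3, §4 Lemma 1. [cite: Beauville2014MaximalPicard, §3 Prop. 3 and §4 Lemma 1]
-/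

noncomputable section

open scoped Matrix Real

open Function Module Matrix

namespace Literature.Geometry.Kaehler

namespace ComplexTorus

/-! ## §1 `dim_ℝ 𝔥𝔤_ℝ(E_{τ₁}^{n₁} × ⋯ × E_{τ_r}^{n_r}) = r` -/

section EllipticPowers

variable {R : Type*} [Fintype R] [DecidableEq R] {τ : R → ℂ} (hτ : ∀ ν, (τ ν).im ≠ 0) (n : R → ℕ)

omit [Fintype R] [DecidableEq R] in
/-- `dim_ℂ ℂ^{n} = n ≥ 1` for the covering space of `E_τⁿ`. [folklore] -/
private theorem finrank_fin_fun_pos {ν : R} (hn : 0 < n ν) : 0 < finrank ℂ (Fin (n ν) → ℂ) := by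
  rwa [Module.finrank_fin_fun]

omit [Fintype R] [DecidableEq R] in
/-- **The powers `E_{τ_ν}^{n_ν}` (`n_ν ≥ 1`) of CM curves are tori on the Hodge-circle locus** (`Hg(E_τⁿ)(ℝ) = h(S¹)`, the powers
of a torus on the locus stay on it). [cite: MoonenZarhin1999LowDim, §1 (p0002 L138–L141: "`Hg(Y^{m}) ≅ Hg(Y)`")]
[cite: Imai1976HodgeGroups, §2 (p. 368 L5–L7) and §3 Remarks (p. 370)] -/
theorem coe_hodgeGroup_ellipticPow_eq_range_of_quadratic (hq : ∀ ν, ∃ a b : ℚ, τ ν ^ 2 + a * τ ν + b = 0)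
    (hn : ∀ ν, 0 < n ν) (ν : R) :
    (hodgeGroup (powPeriod (ellipticPeriod (hτ ν)) (n ν)) : Set (SpecialLinearGroup (Fin (n ν) × Fin 2) ℝ)) =
      Set.range (hodgeCircleSL (powPeriod (ellipticPeriod (hτ ν)) (n ν))) :=
  (coe_hodgeGroup_powPeriod_eq_range_iff (ellipticPeriod (hτ ν)) (by rw [Module.finrank_self]; exact one_pos) (hn ν)).2
    (coe_hodgeGroup_ellipticPeriod_eq_range_of_ne_bot (hτ ν) ((ellipticEnd_ne_bot_iff (hτ ν)).2 (hq ν)))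

/-- **`dim_ℝ 𝔥𝔤_ℝ(E_{τ₁}^{n₁} × ⋯ × E_{τ_r}^{n_r}) = r` FOR PAIRWISE NON-ISOGENOUS CM CURVES AND `n_ν ≥ 1`**: the family of powers
`E_{τ_ν}^{n_ν}` is on the locus with pairwise `Hom(E_{τ_ν}^{n_ν}, E_{τ_μ}^{n_μ}) = 0`, so `𝔥𝔤_ℝ(∏) = ⊕_ν ℝ·J_ν` (g33-#5) — Imai's
«`Hg(∏_{i,j} Eᵢ^{(j)}) ≅ ∏ᵢ Δ_{mᵢ}(Hg(Eᵢ))`», a torus of rank `r`, read on the Lie algebra.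
[cite: Imai1976HodgeGroups, §2 (p. 368 L5–L7), Proposition and §3 Remarks (p. 370 L31–L38)]
[cite: MoonenZarhin1999LowDim, §1 (p0002 L138–L141)] [cite: Gordon1997, §3 Theorem (first bullet)] -/
theorem finrank_hodgeGroupLie_sigmaPi_ellipticPow_eq_card
    (hni : ∀ ν ν', ν ≠ ν' → ¬ IsIsogenous (ellipticPeriod (hτ ν)) (ellipticPeriod (hτ ν')))
    (hq : ∀ ν, ∃ a b : ℚ, τ ν ^ 2 + a * τ ν + b = 0) (hn : ∀ ν, 0 < n ν) :
    finrank ℝ (hodgeGroupLie (sigmaPiPeriod fun ν ↦ powPeriod (ellipticPeriod (hτ ν)) (n ν))) = Fintype.card R :=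
  finrank_hodgeGroupLie_sigmaPiPeriod_eq_card_of_coe_eq_range_of_pairwise_homRat_eq_bot
    (fun ν ↦ powPeriod (ellipticPeriod (hτ ν)) (n ν)) (fun ν ↦ finrank_fin_fun_pos n (hn ν))
    (coe_hodgeGroup_ellipticPow_eq_range_of_quadratic hτ n hq hn)
    fun _ _ hνμ ↦ homRat_powPeriod_eq_bot_of_ne (fun ν ↦ ellipticPeriod (hτ ν)) n
      (fun ν ↦ isSimple_ellipticPeriod (hτ ν)) hni hνμ

/-- **… and `dim_ℝ 𝔪𝔱_ℝ(E_{τ₁}^{n₁} × ⋯ × E_{τ_r}^{n_r}) = r + 1`** (`MT = 𝔾_m · Hg`; non-empty product).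
[cite: GreenGriffithsKerr2012, §I.A (p. 35)] [cite: Lange2023AbelianVarietiesComplex, §7.2.1 Remark 7.2.2 (2)]
[cite: Imai1976HodgeGroups, §3 Remarks (p. 370 L31–L38)] -/
theorem finrank_mumfordTateLie_sigmaPi_ellipticPow_eq_card_add_one [Nonempty R]
    (hni : ∀ ν ν', ν ≠ ν' → ¬ IsIsogenous (ellipticPeriod (hτ ν)) (ellipticPeriod (hτ ν')))
    (hq : ∀ ν, ∃ a b : ℚ, τ ν ^ 2 + a * τ ν + b = 0) (hn : ∀ ν, 0 < n ν) :
    finrank ℝ (mumfordTateLie (sigmaPiPeriod fun ν ↦ powPeriod (ellipticPeriod (hτ ν)) (n ν))) = Fintype.card R + 1 := by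
  haveI : Nonempty (Σ ν : R, Fin (n ν) × Fin 2) :=
    ⟨⟨Classical.arbitrary R, (⟨0, hn _⟩, 0)⟩⟩
  rw [finrank_mumfordTateLie, finrank_hodgeGroupLie_sigmaPi_ellipticPow_eq_card hτ n hni hq hn]

end EllipticPowers

/-! ## §2 Intrinsically: `dim_ℝ 𝔥𝔤_ℝ(∏ₖ X_k)` = the number of CM isogeny classes of the factors -/

section Locus

variable {κ : Type*} [Fintype κ] [DecidableEq κ] {σ : κ → Type*} [∀ k, Fintype (σ k)] [∀ k, DecidableEq (σ k)]
  {F : κ → Type*} [∀ k, NormedAddCommGroup (F k)] [∀ k, NormedSpace ℂ (F k)] [∀ k, FiniteDimensional ℂ (F k)]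
  (Ψ : ∀ k, (σ k → ℝ) ≃L[ℝ] F k)

/-- **THE RANK OF THE HODGE GROUP OF A FINITE PRODUCT OF TORI ON THE HODGE-CIRCLE LOCUS IS THE NUMBER `r` OF CM ISOGENY
CLASSES OF THE FACTORS**: there are `r ≤ #κ` class dimensions `n_ν ≥ 1`, `Σ_ν n_ν = Σₖ g_k` (`∏ₖ X_k ∼ ∏_ν E_{τ_ν}^{n_ν}`, pairwise
non-isogenous CM curves), with **`dim_ℝ 𝔥𝔤_ℝ(∏ₖ X_k) = r`**, `ρ(∏ₖ X_k) = Σ_ν n_ν²` and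
`dim_ℚ H^{2p}_Hodge(∏ₖ X_k) = Σ_{Σ f = p} ∏_ν C(n_ν, f_ν)²` for every `p` — «Decompose `X`, up to isogeny, as
`X ∼ Y₁^{m₁} × ⋯ × Y_r^{m_r}`. Then `Hg(X) = Hg(Y₁^{m₁}) × ⋯`», each `Hg(E_{τ_ν}^{n_ν}) ≅ Hg(E_{τ_ν})` «a 1-dimensional torus».
[cite: Imai1976HodgeGroups, §2 (p. 368 L5–L7) and §3 Remarks (p. 370 L31–L38)] [cite: MoonenZarhin1999LowDim, (0.2)(4) (p0002 L1–L3) and §1 (p0002 L138–L141)]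
[cite: Gordon1997, §3 Theorem (p0013 L55–L62)] [cite: Lange2023AbelianVarietiesComplex, §2.4.4 Thm. 2.4.25 and §7.3.3 Exercise (3)(b)] -/
theorem exists_finrank_hodgeGroupLie_sigmaPiPeriod_eq_of_coe_eq_range (hg : ∀ k, 0 < finrank ℂ (F k))
    (h : ∀ k, (hodgeGroup (Ψ k) : Set (SpecialLinearGroup (σ k) ℝ)) = Set.range (hodgeCircleSL (Ψ k))) :
    ∃ (r : ℕ) (n : Fin r → ℕ), r ≤ Fintype.card κ ∧ (∀ ν, 0 < n ν) ∧ ∑ ν, n ν = ∑ k, finrank ℂ (F k) ∧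
      finrank ℝ (hodgeGroupLie (sigmaPiPeriod Ψ)) = r ∧
      finrank ℤ (neronSeveriGroup (sigmaPiPeriod Ψ)) = ∑ ν, n ν ^ 2 ∧
      ∀ p, finrank ℚ (hodgeClasses (sigmaPiPeriod Ψ) p) =
        ∑ f ∈ (Finset.univ : Finset (Fin r)).piAntidiag p, ∏ ν, (n ν).choose (f ν) ^ 2 := by
  obtain ⟨r, τ, hτ, n, hr, hpq, hne, hn, hsum, -, hiso⟩ := exists_isIsogenous_sigmaPi_ellipticPow_of_coe_eq_range Ψ hg h
  choose a b hab using hpq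
  refine ⟨r, n, hr, hn, hsum, ?_, ?_, fun p ↦ ?_⟩
  · rw [hiso.finrank_hodgeGroupLie_eq, finrank_hodgeGroupLie_sigmaPi_ellipticPow_eq_card hτ n hne
      (fun ν ↦ ⟨a ν, b ν, hab ν⟩) hn, Fintype.card_fin]
  · rw [hiso.finrank_neronSeveriGroup_eq _ _,
      finrank_neronSeveriGroup_powers (fun ν ↦ ellipticPeriod (hτ ν)) n (fun ν ↦ isSimple_ellipticPeriod (hτ ν))
        (fun ν ↦ isAbelianVariety_ellipticPeriod (hτ ν)) hne]
    exact Finset.sum_congr rfl fun ν _ ↦ finrank_neronSeveriGroup_ellipticPow_of_quadratic (hτ ν) (n ν) (hab ν)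
  · rw [hiso.finrank_hodgeClasses_eq _ _ p,
      finrank_hodgeClasses_sigmaPi_ellipticPow_of_quadratic hτ n hne (fun ν ↦ ⟨a ν, b ν, hab ν⟩) p]

omit [Fintype κ] [DecidableEq κ] [∀ k, DecidableEq (σ k)] in
/-- `g_k ≥ 1` for some `k` ⟹ the lattice index `Σ_k σ_k` of the product is non-empty (`#σ_k = 2g_k`). [folklore] -/
private theorem nonempty_sigma_of_finrank_pos [Nonempty κ] (Ψ : ∀ k, (σ k → ℝ) ≃L[ℝ] F k)
    (hg : ∀ k, 0 < finrank ℂ (F k)) : Nonempty (Σ k, σ k) := by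
  have hk : Nonempty (σ (Classical.arbitrary κ)) := by
    rw [← Fintype.card_pos_iff, card_eq_two_mul_finrank (Ψ (Classical.arbitrary κ))]
    exact Nat.mul_pos two_pos (hg _)
  exact ⟨⟨Classical.arbitrary κ, Classical.choice hk⟩⟩

/-- **`dim_ℝ 𝔪𝔱_ℝ(∏ₖ X_k) = r + 1`** with the same `r` (non-empty family; `MT = 𝔾_m · Hg`). [cite: GreenGriffithsKerr2012, §I.A (p. 35)]
[cite: Lange2023AbelianVarietiesComplex, §7.2.1 Remark 7.2.2 (2)] [cite: Imai1976HodgeGroups, §3 Remarks (p. 370 L31–L38)] -/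
theorem exists_finrank_mumfordTateLie_sigmaPiPeriod_eq_of_coe_eq_range [Nonempty κ] (hg : ∀ k, 0 < finrank ℂ (F k))
    (h : ∀ k, (hodgeGroup (Ψ k) : Set (SpecialLinearGroup (σ k) ℝ)) = Set.range (hodgeCircleSL (Ψ k))) :
    ∃ r : ℕ, 1 ≤ r ∧ r ≤ Fintype.card κ ∧ finrank ℝ (hodgeGroupLie (sigmaPiPeriod Ψ)) = r ∧
      finrank ℝ (mumfordTateLie (sigmaPiPeriod Ψ)) = r + 1 := by
  haveI := nonempty_sigma_of_finrank_pos Ψ hg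
  obtain ⟨r, n, hr, hn, hsum, hdim, -, -⟩ := exists_finrank_hodgeGroupLie_sigmaPiPeriod_eq_of_coe_eq_range Ψ hg h
  refine ⟨r, ?_, hr, hdim, by rw [finrank_mumfordTateLie, hdim]⟩
  -- `r ≥ 1`: the `n_ν` sum to `Σ g_k > 0`
  by_contra hr0
  push Not at hr0
  have hr0' : r = 0 := by omega
  subst hr0'
  have hpos : 0 < ∑ k, finrank ℂ (F k) := Finset.sum_pos (fun k _ ↦ hg k) Finset.univ_nonempty
  rw [← hsum] at hpos
  simp at hpos

/-- **`1 ≤ dim_ℝ 𝔥𝔤_ℝ(∏ₖ X_k) ≤ #κ`** for every non-empty finite family of tori on the locus (the rank lies between the two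
extreme branches: `1` = all factors powers of one CM curve, `#κ` = pairwise `Hom = 0`).
[cite: Imai1976HodgeGroups, §3 Remarks (p. 370 L22–L25, L31–L38)] [cite: MoonenZarhin1999LowDim, §3 (1) and Corollary] -/
theorem one_le_finrank_hodgeGroupLie_sigmaPiPeriod_and_le_card [Nonempty κ] (hg : ∀ k, 0 < finrank ℂ (F k))
    (h : ∀ k, (hodgeGroup (Ψ k) : Set (SpecialLinearGroup (σ k) ℝ)) = Set.range (hodgeCircleSL (Ψ k))) :
    1 ≤ finrank ℝ (hodgeGroupLie (sigmaPiPeriod Ψ)) ∧ finrank ℝ (hodgeGroupLie (sigmaPiPeriod Ψ)) ≤ Fintype.card κ := by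
  obtain ⟨r, h1, hr, hdim, -⟩ := exists_finrank_mumfordTateLie_sigmaPiPeriod_eq_of_coe_eq_range Ψ hg h
  exact ⟨hdim ▸ h1, hdim ▸ hr⟩

/-! ## §3 By `Hom`-classes: `dim_ℝ 𝔥𝔤_ℝ(∏ₖ X_k) = #R` for every colouring `d : κ ↠ R` -/

variable {R : Type*} [Fintype R] [DecidableEq R] {d : κ → R}

omit [DecidableEq κ] [∀ k, Fintype (σ k)] [∀ k, DecidableEq (σ k)] [∀ k, FiniteDimensional ℂ (F k)] [Fintype R] in
/-- Every class of a surjective colouring carries a positive total dimension `nᵢ = Σ_{d k = i} g_k ≥ 1`. [folklore] -/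
private theorem sum_filter_finrank_pos (hg : ∀ k, 0 < finrank ℂ (F k)) (hsurj : Function.Surjective d)
    (i : R) : 0 < ∑ k ∈ Finset.univ.filter (fun k ↦ d k = i), finrank ℂ (F k) := by
  obtain ⟨k, hk⟩ := hsurj i
  exact Finset.sum_pos' (fun l _ ↦ (hg l).le) ⟨k, Finset.mem_filter.2 ⟨Finset.mem_univ k, hk⟩, hg k⟩

/-- **`dim_ℝ 𝔥𝔤_ℝ(∏ₖ X_k) = #R` FOR EVERY COLOURING `d : κ ↠ R` OF THE FACTORS BY `Hom`-CLASSES** (`d k = d l ⟺ Hom_ℚ(X_k, X_l) ≠ 0`):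
`∏ₖ X_k ∼ ∏_t E_{σ_{c(t)}} ∼ ∏ᵢ E_{σᵢ}^{nᵢ}` (g34-#1's engine and regrouping; `nᵢ = Σ_{d k = i} g_k ≥ 1`, the `E_{σᵢ}` pairwise
non-isogenous CM curves), `dim_ℝ 𝔥𝔤_ℝ` is an isogeny invariant, and §1.
[cite: Imai1976HodgeGroups, §3 Remarks (p. 370 L31–L38)] [cite: MoonenZarhin1999LowDim, (0.2)(4) (p0002 L1–L3) and §1 (p0002 L138–L141)]
[cite: Gordon1997, §3 Theorem (first bullet)] -/
theorem finrank_hodgeGroupLie_sigmaPiPeriod_eq_card_of_homColouring (hg : ∀ k, 0 < finrank ℂ (F k))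
    (h : ∀ k, (hodgeGroup (Ψ k) : Set (SpecialLinearGroup (σ k) ℝ)) = Set.range (hodgeCircleSL (Ψ k)))
    (hd : ∀ k l, d k = d l ↔ homRat (Ψ k) (Ψ l) ≠ ⊥) (hsurj : Function.Surjective d) :
    finrank ℝ (hodgeGroupLie (sigmaPiPeriod Ψ)) = Fintype.card R := by
  obtain ⟨ς, hς, N, c, hq, hni, -, hcard, -, hiso⟩ :=
    exists_isIsogenous_sigmaPiPeriod_piPeriod_of_homColouring Ψ hg h hd hsurj
  have hn : ∀ i, 0 < (colourSet c i).card := fun i ↦ by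
    rw [hcard i]
    exact sum_filter_finrank_pos hg hsurj i
  rw [hiso.finrank_hodgeGroupLie_eq,
    (isIsogenous_piPeriod_comp_sigmaPi_powPeriod (fun i ↦ ellipticPeriod (hς i)) c).finrank_hodgeGroupLie_eq,
    finrank_hodgeGroupLie_sigmaPi_ellipticPow_eq_card hς (fun i ↦ (colourSet c i).card) hni hq hn]

/-- **… and `dim_ℝ 𝔪𝔱_ℝ(∏ₖ X_k) = #R + 1`** for every colouring by `Hom`-classes (non-empty family).
[cite: GreenGriffithsKerr2012, §I.A (p. 35)] [cite: Lange2023AbelianVarietiesComplex, §7.2.1 Remark 7.2.2 (2)] -/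
theorem finrank_mumfordTateLie_sigmaPiPeriod_eq_card_add_one_of_homColouring [Nonempty κ] (hg : ∀ k, 0 < finrank ℂ (F k))
    (h : ∀ k, (hodgeGroup (Ψ k) : Set (SpecialLinearGroup (σ k) ℝ)) = Set.range (hodgeCircleSL (Ψ k)))
    (hd : ∀ k l, d k = d l ↔ homRat (Ψ k) (Ψ l) ≠ ⊥) (hsurj : Function.Surjective d) :
    finrank ℝ (mumfordTateLie (sigmaPiPeriod Ψ)) = Fintype.card R + 1 := by
  haveI := nonempty_sigma_of_finrank_pos Ψ hg
  rw [finrank_mumfordTateLie, finrank_hodgeGroupLie_sigmaPiPeriod_eq_card_of_homColouring Ψ hg h hd hsurj]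

/-- **THE NUMBER OF `Hom`-CLASSES IS WELL DEFINED**: two colourings `d : κ ↠ R`, `d' : κ ↠ R'` of the factors by `Hom`-classes
have `#R = #R'` (`= dim_ℝ 𝔥𝔤_ℝ(∏ₖ X_k)`). [cite: Imai1976HodgeGroups, §3 Remarks (p. 370 L31–L38)]
[cite: MoonenZarhin1999LowDim, (0.2)(4) and §1 (p0002 L138–L141)] -/
theorem card_eq_card_of_homColouring {R' : Type*} [Fintype R'] [DecidableEq R'] {d' : κ → R'}
    (hg : ∀ k, 0 < finrank ℂ (F k))
    (h : ∀ k, (hodgeGroup (Ψ k) : Set (SpecialLinearGroup (σ k) ℝ)) = Set.range (hodgeCircleSL (Ψ k)))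
    (hd : ∀ k l, d k = d l ↔ homRat (Ψ k) (Ψ l) ≠ ⊥) (hsurj : Function.Surjective d)
    (hd' : ∀ k l, d' k = d' l ↔ homRat (Ψ k) (Ψ l) ≠ ⊥) (hsurj' : Function.Surjective d') :
    Fintype.card R = Fintype.card R' := by
  rw [← finrank_hodgeGroupLie_sigmaPiPeriod_eq_card_of_homColouring Ψ hg h hd hsurj,
    finrank_hodgeGroupLie_sigmaPiPeriod_eq_card_of_homColouring Ψ hg h hd' hsurj']

/-- **The number of `Hom`-classes is at most the number of factors** (`#R ≤ #κ`). [cite: Imai1976HodgeGroups, §3 Remarks (p. 370 L31–L38)]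
[cite: GreenGriffithsKerr2012, §III.B (i) (p. 72)] -/
theorem card_le_card_of_homColouring (hg : ∀ k, 0 < finrank ℂ (F k))
    (h : ∀ k, (hodgeGroup (Ψ k) : Set (SpecialLinearGroup (σ k) ℝ)) = Set.range (hodgeCircleSL (Ψ k)))
    (hd : ∀ k l, d k = d l ↔ homRat (Ψ k) (Ψ l) ≠ ⊥) (hsurj : Function.Surjective d) :
    Fintype.card R ≤ Fintype.card κ := by
  rw [← finrank_hodgeGroupLie_sigmaPiPeriod_eq_card_of_homColouring Ψ hg h hd hsurj]
  exact finrank_hodgeGroupLie_sigmaPiPeriod_le_card_of_coe_eq_range Ψ hg h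

/-! ## §4 `dim_ℝ 𝔥𝔤_ℝ(∏ₖ X_k) = 1` ⟺ all pairwise `Hom ≠ 0` -/

/-- **`dim_ℝ 𝔥𝔤_ℝ(∏ₖ X_k) = 1` ⟺ `Hom_ℚ(X_k, X_l) ≠ 0` FOR ALL `k ≠ l`** (⟺ the product is itself on the locus, g33-#8 §4;
non-empty family): rank one is the branch where all the CM curves of the factors are isogenous (Imai: «the Hodge group of
`E₁ × E₂` is … the diagonal» for isogenous CM curves). [cite: Imai1976HodgeGroups, §3 Remarks (p. 370 L22–L25)]
[cite: MoonenZarhin1999LowDim, §1 and §3 Corollary] [cite: Beauville2014MaximalPicard, §3 Prop. 3 and §4 Lemma 1] -/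
theorem finrank_hodgeGroupLie_sigmaPiPeriod_eq_one_iff_forall_homRat_ne_bot [Nonempty κ] (hg : ∀ k, 0 < finrank ℂ (F k))
    (h : ∀ k, (hodgeGroup (Ψ k) : Set (SpecialLinearGroup (σ k) ℝ)) = Set.range (hodgeCircleSL (Ψ k))) :
    finrank ℝ (hodgeGroupLie (sigmaPiPeriod Ψ)) = 1 ↔ ∀ k l, k ≠ l → homRat (Ψ k) (Ψ l) ≠ ⊥ := by
  refine ⟨fun h1 k l _ ↦ ?_, finrank_hodgeGroupLie_sigmaPiPeriod_eq_one_of_forall_homRat_ne_bot Ψ hg h⟩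
  obtain ⟨r, d, -, hsurj, hd⟩ := exists_homColouring_of_coe_eq_range Ψ hg h
  have hr : r = 1 := by
    rw [← Fintype.card_fin r, ← finrank_hodgeGroupLie_sigmaPiPeriod_eq_card_of_homColouring Ψ hg h hd hsurj, h1]
  subst hr
  exact (hd k l).1 (Subsingleton.elim _ _)

/-- **… ⟺ the product `∏ₖ X_k` is itself on the Hodge-circle locus** (`Hg(∏ₖ X_k)(ℝ) = h(S¹)`).
[cite: Imai1976HodgeGroups, §2 (p. 368 L5–L7) and §3 Remarks (p. 370)] [cite: Beauville2014MaximalPicard, §3 Prop. 3] -/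
theorem finrank_hodgeGroupLie_sigmaPiPeriod_eq_one_iff_coe_eq_range [Nonempty κ] (hg : ∀ k, 0 < finrank ℂ (F k))
    (h : ∀ k, (hodgeGroup (Ψ k) : Set (SpecialLinearGroup (σ k) ℝ)) = Set.range (hodgeCircleSL (Ψ k))) :
    finrank ℝ (hodgeGroupLie (sigmaPiPeriod Ψ)) = 1 ↔
      (hodgeGroup (sigmaPiPeriod Ψ) : Set (SpecialLinearGroup (Σ k, σ k) ℝ)) =
        Set.range (hodgeCircleSL (sigmaPiPeriod Ψ)) := by
  rw [finrank_hodgeGroupLie_sigmaPiPeriod_eq_one_iff_forall_homRat_ne_bot Ψ hg h,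
    coe_hodgeGroup_sigmaPiPeriod_eq_range_iff_forall_homRat_ne_bot Ψ hg h]

/-! ## §5 `𝔥𝔤_ℝ(∏ₖ X_k)` is commutative -/

omit [∀ k, FiniteDimensional ℂ (F k)] [Fintype R] [DecidableEq R] in
/-- **`𝔥𝔤_ℝ(∏ₖ X_k)` IS A COMMUTATIVE LIE ALGEBRA for every finite family of tori on the Hodge-circle locus** (g33-#5's
`hodgeGroup_sigmaPiPeriod_comm_of_coe_eq_range`: `Hg(∏ₖ X_k)(ℝ) ⊆ ∏ₖ h_k(S¹)` is commutative, and Hall's Prop. 3.22 in the tree's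
form `hodgeGroupLie_comm_of_hodgeGroup_comm`) — the product is of CM-type: «`Hg(X)` is a torus if and only if `X` is of CM-type».
[cite: MoonenZarhin1999LowDim, §1 (p0002) and (0.2)(4)] [cite: Lange2023AbelianVarietiesComplex, §7.2.3 Prop. 7.2.6]
[cite: Imai1976HodgeGroups, §3 Remarks (p. 370 L31–L38)] -/
theorem hodgeGroupLie_sigmaPiPeriod_comm_of_coe_eq_range
    (h : ∀ k, (hodgeGroup (Ψ k) : Set (SpecialLinearGroup (σ k) ℝ)) = Set.range (hodgeCircleSL (Ψ k))) :
    ∀ X ∈ hodgeGroupLie (sigmaPiPeriod Ψ), ∀ Y ∈ hodgeGroupLie (sigmaPiPeriod Ψ), X * Y = Y * X :=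
  fun _ hX _ hY ↦ hodgeGroupLie_comm_of_hodgeGroup_comm (sigmaPiPeriod Ψ)
    (fun _ hM _ hN ↦ hodgeGroup_sigmaPiPeriod_comm_of_coe_eq_range Ψ h hM hN) hX hY

end Locus

end ComplexTorus

end Literature.Geometry.Kaehler
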